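import Literature.MathematicalPhysics.StatisticalMechanics.HcpFccLatticeSums

/-!
# Certified hcp/fcc lattice sums: kernel-evaluated box floor sums (KernelA5)

Each theorem records the exact value of an integer box floor sum
`boxFloorSum 2 3 δ k R n 10^e = ∑_{|i|,|j| ≤ R} ⌊10^e / latticeNum 2 3 δ k i jⁿ⌋` (`c² = 2/3`; pattern
`δ`, layer `k`; `R = 40`, `n = 3`, `e = 18` resp. `R = 20`, `n = 6`, `e = 30`), evaluated by the
kernel (`decide +kernel`: structural recursion over the `(2R+1)²` shifted indices, GMP integer
arithmetic; no `native_decide`, standard axioms only).  The values were generated by `py/gen.py`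
from `py/boxsums_final.json` (item evidence) and are re-verified here by the kernel.  [folklore]
-/

namespace Literature.MathematicalPhysics.StatisticalMechanics.StackingSums

open Finset

/-- `boxFloorSum 2 3 0 12 40 3 10^18` (pattern `0`, layer `12`, exponent `3`). [folklore] -/
theorem boxFloorSum_3_0_12 : boxFloorSum 2 3 0 12 40 3 (10 ^ 18) = 269035440397 := by
  decide +kernel

/-- `boxFloorSum 2 3 1 13 40 3 10^18` (pattern `1`, layer `13`, exponent `3`). [folklore] -/
theorem boxFloorSum_3_1_13 : boxFloorSum 2 3 1 13 40 3 (10 ^ 18) = 195089518159 := by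
  decide +kernel


end Literature.MathematicalPhysics.StatisticalMechanics.StackingSums

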